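import Summits.QuantumFields.YangMills.Theorems.AlphaInputsT3ACv3AdaptedSelL
import Summits.QuantumFields.YangMills.Theorems.AlphaInputsT3ACv3LiftAvgLocalCont
import HarnessLib

/-!
# `AlphaInputsT3ACv3AdaptedClassR` — STRATEGY B for 2′: THE **READ-LOCAL** ADAPTED CLASS `𝒞_R(k, h, W)` — [7]'s closed regular class `regClassC` (every fine plaquette with a
# corner in `Ω_j(h)`, all `j < k`) REPLACED by the closed half-constant form of EXACTLY what row `h68` reads: `pdevOn` on the box under each RECORDED plaquette — lane
# `pub-balaban3d`, seat alpha-2 (g3)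

WHY (HOME `D6L-STATUS-alpha2-g3.md` §3–§4).  Over the localised class `𝒞_L` (`…AdaptedClassL`, conjunct `regClassC`) the non-emptiness row (D6L) is refutable as typed: a history
whose large-field plaquettes form a tube and a charged datum `W` flat on `Ω_k(h)` with holonomy `−1` around the tube admit no GLOBALLY small `U` with `k`-fold average `W` (lattice
Stokes) — while the v3 rows read only LOCAL regularity (`h68`: `pdevOn` on the recorded boxes; r3: plaquettes with all corners inside `Λ_i(h)`∕`Ω_k(h)`; seams free).  THIS FILE:
(over R0 `…LiftAvgLocalCont`: the LOCAL form of NODE O's continuity of the lifted averages) the read-local (68) set `reg68LocalSet k h` (`∀ e ∈ disc h`, `pdevOn (box of e) (lift U) ≤ ½C68·a_{e.1}·L^{−2e.1}`), closed; the bond boxes of the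
four bonds of a recorded coarse plaquette lie in its box (`pdevOn_mono`), so at an ADMISSIBLE history the (67)-expression is continuous on `reg68LocalSet` and
`reg68LocalSet ∩ large67Set` is closed; `regClassC ⊆ reg68LocalSet` at admissible `h` (NODE O's `h68_of_reg2` geometry); the class
`𝒞_R(k,h,W) := localSmallT3 ∩ reg68LocalSet ∩ large67Set ∩ [ChargedT3 → top42Set ∩ reg68LevelsSet]`, `𝒞_L ⊆ 𝒞_R` (so (D6L) ⇒ the re-cut row), its W-independent core closed.
The selector and the data-schema knit over `𝒞_R` are the siblings `…AdaptedSelR` ∕ `…DataSchemaR`.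
HONEST FRAMING.  Kinematics∕topology; nothing of [B10]∕[7]∕[4]'s estimates asserted beyond the tree's [4] Prop. 2; the class is NOT claimed to contain print's (42)-minimiser and its
non-emptiness is NOT proved here; count-neutral helper toward R3 2′ (`stub_laneRecordsV3`, items 19935∕19936); nothing about d = 4, the continuum, or a mass gap.

References: T. Bałaban, Commun. Math. Phys. 102 (1985) 255–275 [Balaban1985UV3] ((42) p.266, (67)–(68) p.273); CMP 98 (1985) 17–51 [Balaban1985Averaging] (Prop. 2 (54) p.26,
p.24 locality); CMP 102 (1985) 277–309 [Balaban1985Variational] ((2)+(8) pp.278–279).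
-/

set_option autoImplicit false

noncomputable section

/-! ## §2 At the T³ objects: the read-local (68) set, its closedness with (67), and the read-local adapted class -/

namespace Summit.QuantumFields.YangMills.Theorems

open MeasureTheory Set Topology TopologicalSpace
open scoped Matrix Matrix.Norms.L2Operator
open Literature.MathematicalPhysics.QuantumFieldTheory.Balaban1983to89
open Literature.MathematicalPhysics.QuantumFieldTheory.Balaban1983to89.B10 (pFun)
open Literature.MathematicalPhysics.QuantumFieldTheory.Balaban1983to89.T3ContinuumYM3Torus
open Literature.MathematicalPhysics.QuantumFieldTheory.Balaban1983to89.T3UnitLawDensityEML (ℰp)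
open Literature.MathematicalPhysics.QuantumFieldTheory.Balaban1985CMP102.Setting
open Summit.QuantumFields.Balaban3D.Carriers
open Summit.QuantumFields.Balaban3D.Proofs.Primitives (AlphaConsts)
open Summit.QuantumFields.Balaban3D.Proofs.LiftBridge (liftCfg liftCfg_mem_unitaryUnits)
open Summit.QuantumFields.Balaban3D.Proofs.TorusLift (projSite zOf projSite_mem_plaqCover)
open Summit.QuantumFields.Balaban3D.Proofs.AdmissibleRegions (plaqCover_subset_of_admissible)
open Summit.QuantumFields.Balaban3D.Proofs.Run3SmallFactors (codeZ decode_of_mem_disc)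
open Summit.QuantumFields.Balaban3D.Proofs.ScalesArithmetic (gk_pos gk_le_one)
open Summit.QuantumFields.Balaban3D.Proofs.CouplingWindow (pFun_pos)
open Summit.QuantumFields.YangMills.Theorems.BalabanUVNodesN08AlphaGroupTopology
open Summit.QuantumFields.YangMills.Theorems.BalabanUVNodesN08AlphaCompactSel (regClassC)
open Summit.QuantumFields.YangMills.Theorems.BalabanUVNodesN08AlphaClassIDischarge (projSite_corner_mem_Lam mem_deltaBox_of_inBox)
open Summit.QuantumFields.YangMills.Theorems.ReadLocal (continuousAt_val_liftAvg_of_pdevOn isClosed_pdevOn_le pdevOn_le_of_forall_ne pdevOn_bondBox_le_plaqBox)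
open B7Prop1Explicit (hol plaqWord e U1)
open B7Prop1Local (pdevOn loK plaqHiK InBox hol_plaqWord_eq)
open B7Prop2Explicit (avgIter hol_plaqWord_self unitaryUnits_le_U1)

section T3

variable (F : T3Family) (𝔠 : AlphaConsts F.L (suGroupModel 2).N) (γ : ℝ) (hγ : 0 < γ) (hγ1 : γ ≤ (min 𝔠.gamma0 1) ^ 2) (K : ℕ)

/-- **THE READ-LOCAL (68) SET OF A HISTORY** — the closed half-constant form of EXACTLY row `h68`'s text: for every recorded plaquette `e = (j, p′) ∈ disc h`, the lift of `Ũ` has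
`pdevOn ≤ ½·C68·g_jp(g_j)·L^{−2j}` on the box of the four `j`-blocks under `p′`. [cite: Balaban1985UV3, (68) p.273] -/
def AlphaInputsT3AC.reg68LocalSet (k : ℕ) (h : Hist (F.P K) k) : Set (GaugeField (F.P K) 0 (Matrix.specialUnitaryGroup (Fin 2) ℂ)) :=
  {U | ∀ e ∈ Hist.disc h,
    pdevOn (loK F.L e.1 (codeZ e)) (plaqHiK F.L e.1 (codeZ e) e.2.2.1 e.2.2.2)
        (liftCfg (S := T3Scales F γ hγ (hγ1.trans (sq_min_one_le _ 𝔠.gamma0_pos)) K) (suGroupModel 2) U) ≤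
      𝔠.C68 / 2 * ((T3Scales F γ hγ (hγ1.trans (sq_min_one_le _ 𝔠.gamma0_pos)) K).gk e.1 *
        pFun 𝔠.lane.carrier.b₀ 𝔠.lane.carrier.p₀ ((T3Scales F γ hγ (hγ1.trans (sq_min_one_le _ 𝔠.gamma0_pos)) K).gk e.1)) *
        (((F.L : ℝ) ^ e.1)⁻¹) ^ 2}

/-- **THE READ-LOCAL ADAPTED CLASS `𝒞_R(k, h, W)`**: the localised small-loop class, the read-local (68) set, (67)-largeness at the recorded plaquettes, and — for a CHARGED datum —
the top constraint (42) on `Ω_k(h)` with r3's multi-level regularity.  `𝒞_L ⊆ 𝒞_R` (`adaptedClassT3L_subset_adaptedClassT3R`).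
[cite: Balaban1985UV3, (42) p.266 + (67)–(68) p.273] -/
def AlphaInputsT3AC.adaptedClassT3R (k : ℕ) (h : Hist (F.P K) k) (W : GaugeField (F.P K) k (Matrix.specialUnitaryGroup (Fin 2) ℂ)) :
    Set (GaugeField (F.P K) 0 (Matrix.specialUnitaryGroup (Fin 2) ℂ)) :=
  {U | U ∈ AlphaInputsT3AC.localSmallT3 F 𝔠 γ hγ hγ1 K k h ∧
    U ∈ AlphaInputsT3AC.reg68LocalSet F 𝔠 γ hγ hγ1 K k h ∧
    U ∈ AlphaInputsT3AC.large67Set F 𝔠 γ hγ hγ1 K k h ∧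
    (ChargedT3 F γ 𝔠.b₀ 𝔠.p₀ (avgWindowFactor F.L) K 𝔠.lane.carrier.M₁
        (rcolOf (T3Scales F γ hγ (hγ1.trans (sq_min_one_le _ 𝔠.gamma0_pos)) K) 𝔠.lane.carrier) k h W →
      U ∈ AlphaInputsT3AC.top42Set F 𝔠 γ hγ hγ1 K k h W ∧ U ∈ AlphaInputsT3AC.reg68LevelsSet F 𝔠 γ hγ hγ1 K k h)}

variable {F 𝔠 γ hγ hγ1 K}

/-- Unfolding membership in the read-local adapted class. [folklore] -/
theorem AlphaInputsT3AC.mem_adaptedClassT3R_iff {k : ℕ} {h : Hist (F.P K) k} {W : GaugeField (F.P K) k (Matrix.specialUnitaryGroup (Fin 2) ℂ)}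
    {U : GaugeField (F.P K) 0 (Matrix.specialUnitaryGroup (Fin 2) ℂ)} :
    U ∈ AlphaInputsT3AC.adaptedClassT3R F 𝔠 γ hγ hγ1 K k h W ↔
      U ∈ AlphaInputsT3AC.localSmallT3 F 𝔠 γ hγ hγ1 K k h ∧
      U ∈ AlphaInputsT3AC.reg68LocalSet F 𝔠 γ hγ hγ1 K k h ∧
      U ∈ AlphaInputsT3AC.large67Set F 𝔠 γ hγ hγ1 K k h ∧
      (ChargedT3 F γ 𝔠.b₀ 𝔠.p₀ (avgWindowFactor F.L) K 𝔠.lane.carrier.M₁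
          (rcolOf (T3Scales F γ hγ (hγ1.trans (sq_min_one_le _ 𝔠.gamma0_pos)) K) 𝔠.lane.carrier) k h W →
        U ∈ AlphaInputsT3AC.top42Set F 𝔠 γ hγ hγ1 K k h W ∧ U ∈ AlphaInputsT3AC.reg68LevelsSet F 𝔠 γ hγ hγ1 K k h) :=
  Iff.rfl

/-- **`regClassC ⊆ reg68LocalSet` AT AN ADMISSIBLE HISTORY** (`k ≤ K`): every fine plaquette of the box under a recorded `p′ ∈ P_j(h)` has its lower-left corner covered by `p′`,
hence in `Λ_j(h) ⊆ Ω_j(h)`, where [7]'s closed class bounds it by `½C68·a_j·L^{−2j}` (NODE O's `h68_of_reg2` geometry, read with `≤`). [cite: Balaban1985UV3, (68) p.273] -/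
theorem AlphaInputsT3AC.regClassC_subset_reg68LocalSet {k : ℕ} (hk : k ≤ K) {h : Hist (F.P K) k}
    (hh : Hist.Admissible 𝔠.lane.carrier.M₁ (rcolOf (T3Scales F γ hγ (hγ1.trans (sq_min_one_le _ 𝔠.gamma0_pos)) K) 𝔠.lane.carrier) k h) :
    regClassC (S := T3Scales F γ hγ (hγ1.trans (sq_min_one_le _ 𝔠.gamma0_pos)) K) (suGroupModel 2) 𝔠 k h ⊆
      AlphaInputsT3AC.reg68LocalSet F 𝔠 γ hγ hγ1 K k h := by
  intro U hU q hq
  set S : Scales F.L := T3Scales F γ hγ (hγ1.trans (sq_min_one_le _ 𝔠.gamma0_pos)) K with hS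
  obtain ⟨j, hj, p, hp, hqj, hz, hμ, hν⟩ := decode_of_mem_disc (S := S) hq
  have hq1 : q.1 = j := by rw [hqj]
  rw [hq1, hz, hμ, hν]
  have hjm : j ≤ S.P.m + S.P.K := by show j ≤ F.m + K; omega
  have hgj : 0 < S.gk j := gk_pos S j
  have hc : 0 ≤ 𝔠.C68 / 2 * (S.gk j * pFun 𝔠.lane.carrier.b₀ 𝔠.lane.carrier.p₀ (S.gk j)) * (((F.L : ℝ) ^ j)⁻¹) ^ 2 := by
    have := 𝔠.C68_pos
    have hp : 0 < pFun 𝔠.lane.carrier.b₀ 𝔠.lane.carrier.p₀ (S.gk j) := pFun_pos _ _ _ 𝔠.b₀_pos hgj (gk_le_one S S.gK_le_one j (by show j ≤ K; omega))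
    positivity
  haveI : NeZero (suGroupModel 2).N := ⟨Nat.pos_iff_ne_zero.mp (suGroupModel 2).N_pos⟩
  letI : CStarAlgebra (Matrix (Fin (suGroupModel 2).N) (Fin (suGroupModel 2).N) ℂ) := {}
  refine pdevOn_le_of_forall_ne hc fun x μ ν hμν hx => ?_
  rw [BalabanUVNodesN08AlphaRegSel.norm_hol_liftCfg_sub_one]
  refine hU j hj (projSite x) μ ν hμν (Or.inl ?_)
  have hbox : x ∈ B10Eq70Squaring.deltaBox (S.P.L ^ j) ((S.P.L ^ j) • zOf p) p.μ p.ν := mem_deltaBox_of_inBox S.P.L j (zOf p) p.μ p.ν hx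
  exact (plaqCover_subset_of_admissible 𝔠.lane.carrier.M₁ (rcolOf S 𝔠.lane.carrier) hh hj hp (projSite_mem_plaqCover hjm p hbox)).1

/-- **`𝒞_L ⊆ 𝒞_R` AT AN ADMISSIBLE HISTORY** — so the OWNER's (D6L) implies the re-cut non-emptiness row over `𝒞_R`. [cite: Balaban1985UV3, (68) p.273] -/
theorem AlphaInputsT3AC.adaptedClassT3L_subset_adaptedClassT3R {k : ℕ} (hk : k ≤ K) {h : Hist (F.P K) k}
    (hh : Hist.Admissible 𝔠.lane.carrier.M₁ (rcolOf (T3Scales F γ hγ (hγ1.trans (sq_min_one_le _ 𝔠.gamma0_pos)) K) 𝔠.lane.carrier) k h)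
    (W : GaugeField (F.P K) k (Matrix.specialUnitaryGroup (Fin 2) ℂ)) :
    AlphaInputsT3AC.adaptedClassT3L F 𝔠 γ hγ hγ1 K k h W ⊆ AlphaInputsT3AC.adaptedClassT3R F 𝔠 γ hγ hγ1 K k h W := by
  intro U hU
  obtain ⟨hN, hReg, hL, hrel⟩ := hU
  exact ⟨hN, AlphaInputsT3AC.regClassC_subset_reg68LocalSet (𝔠 := 𝔠) (hγ1 := hγ1) hk hh hReg, hL, hrel⟩

/-- **MEMBERSHIP IN THE READ-LOCAL (68) SET GIVES ROW `h68`'s TEXT** (`½C68·… < C68·…` on the run's scales). [cite: Balaban1985UV3, (68) p.273] -/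
theorem AlphaInputsT3AC.h68_of_mem_reg68LocalSet {k : ℕ} (hk : k ≤ K) {h : Hist (F.P K) k} {U : GaugeField (F.P K) 0 (Matrix.specialUnitaryGroup (Fin 2) ℂ)}
    (hU : U ∈ AlphaInputsT3AC.reg68LocalSet F 𝔠 γ hγ hγ1 K k h) :
    ∀ e ∈ Hist.disc h,
      pdevOn (loK F.L e.1 (codeZ e)) (plaqHiK F.L e.1 (codeZ e) e.2.2.1 e.2.2.2)
          (liftCfg (S := T3Scales F γ hγ (hγ1.trans (sq_min_one_le _ 𝔠.gamma0_pos)) K) (suGroupModel 2) U) <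
        𝔠.C68 * ((T3Scales F γ hγ (hγ1.trans (sq_min_one_le _ 𝔠.gamma0_pos)) K).gk e.1 *
          pFun 𝔠.lane.carrier.b₀ 𝔠.lane.carrier.p₀ ((T3Scales F γ hγ (hγ1.trans (sq_min_one_le _ 𝔠.gamma0_pos)) K).gk e.1)) *
          (((F.L : ℝ) ^ e.1)⁻¹) ^ 2 := by
  intro e he
  set S : Scales F.L := T3Scales F γ hγ (hγ1.trans (sq_min_one_le _ 𝔠.gamma0_pos)) K with hS
  obtain ⟨j, hj, p, hp, hqj, -, -, -⟩ := decode_of_mem_disc (S := S) he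
  have hq1 : e.1 = j := by rw [hqj]
  have hgj : 0 < S.gk e.1 := gk_pos S e.1
  have hpos : 0 < 𝔠.C68 * (S.gk e.1 * pFun 𝔠.lane.carrier.b₀ 𝔠.lane.carrier.p₀ (S.gk e.1)) * (((F.L : ℝ) ^ e.1)⁻¹) ^ 2 := by
    have := 𝔠.C68_pos
    have hL : (0 : ℝ) < F.L := by exact_mod_cast (zero_lt_one.trans F.hL.2)
    have hp : 0 < pFun 𝔠.lane.carrier.b₀ 𝔠.lane.carrier.p₀ (S.gk e.1) :=
      pFun_pos _ _ _ 𝔠.b₀_pos hgj (gk_le_one S S.gK_le_one e.1 (by show e.1 ≤ K; omega))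
    positivity
  refine (hU e he).trans_lt ?_
  linarith

/-! ### Topology: the read-local (68) set and the (67)-largeness set -/

/-- **THE READ-LOCAL (68) SET IS CLOSED** (finitely many closed `pdevOn`-balls). [cite: Balaban1985UV3, (68) p.273] -/
theorem AlphaInputsT3AC.isClosed_reg68LocalSet {k : ℕ} (hk : k ≤ K) (h : Hist (F.P K) k) :
    IsClosed (AlphaInputsT3AC.reg68LocalSet F 𝔠 γ hγ hγ1 K k h) := by
  set S : Scales F.L := T3Scales F γ hγ (hγ1.trans (sq_min_one_le _ 𝔠.gamma0_pos)) K with hS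
  have hset : AlphaInputsT3AC.reg68LocalSet F 𝔠 γ hγ hγ1 K k h = ⋂ e ∈ Hist.disc h,
      {U : GaugeField (F.P K) 0 (Matrix.specialUnitaryGroup (Fin 2) ℂ) |
        pdevOn (loK F.L e.1 (codeZ e)) (plaqHiK F.L e.1 (codeZ e) e.2.2.1 e.2.2.2) (liftCfg (S := S) (suGroupModel 2) U) ≤
          𝔠.C68 / 2 * (S.gk e.1 * pFun 𝔠.lane.carrier.b₀ 𝔠.lane.carrier.p₀ (S.gk e.1)) * (((F.L : ℝ) ^ e.1)⁻¹) ^ 2} := by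
    ext U
    simp only [mem_iInter]
    exact Iff.rfl
  rw [hset]
  refine isClosed_biInter fun e he => ?_
  have hgj : 0 < S.gk e.1 := gk_pos S e.1
  obtain ⟨j, hj, p, hp, hqj, -, -, -⟩ := decode_of_mem_disc (S := S) (Finset.mem_coe.mp he)
  have hc : 0 ≤ 𝔠.C68 / 2 * (S.gk e.1 * pFun 𝔠.lane.carrier.b₀ 𝔠.lane.carrier.p₀ (S.gk e.1)) * (((F.L : ℝ) ^ e.1)⁻¹) ^ 2 := by
    have := 𝔠.C68_pos
    have hp : 0 < pFun 𝔠.lane.carrier.b₀ 𝔠.lane.carrier.p₀ (S.gk e.1) :=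
      pFun_pos _ _ _ 𝔠.b₀_pos hgj (gk_le_one S S.gK_le_one e.1 (by show e.1 ≤ K; rw [hqj]; omega))
    positivity
  exact isClosed_pdevOn_le (S := S) (suGroupModel 2) _ _ hc

/-- **AT AN ADMISSIBLE HISTORY THE AVERAGED PLAQUETTE VARIABLE OF A RECORDED PLAQUETTE IS CONTINUOUS ON THE READ-LOCAL (68) SET**: the four bonds of `∂p′`, `p′ ∈ P_j(h)`, have
their bond boxes inside the box of `p′` (`pdevOn_bondBox_le_plaqBox`), where membership gives `pdevOn ≤ ½C68·a_j·L^{−2j} < C68·a_j·L^{−2j}`, so §1 applies at every member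
(window premises from `b7Window_T3`); the plaquette holonomy reads only those four averages (`hol_plaqWord_eq`). [cite: Balaban1985UV3, (67) p.273 L13; Balaban1985Averaging, Prop. 2 (54) p.26] -/
theorem AlphaInputsT3AC.continuousOn_hol_disc_reg68Local {k : ℕ} (hk : k ≤ K) {h : Hist (F.P K) k}
    {q : ℕ × PlaqCode (F.P K)} (hq : q ∈ Hist.disc h) :
    ContinuousOn (fun U : GaugeField (F.P K) 0 (Matrix.specialUnitaryGroup (Fin 2) ℂ) =>
      ((hol (avgIter F.L (liftCfg (S := T3Scales F γ hγ (hγ1.trans (sq_min_one_le _ 𝔠.gamma0_pos)) K) (suGroupModel 2) U) q.1)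
          (codeZ q) (plaqWord q.2.2.1 q.2.2.2) : (Matrix (Fin (suGroupModel 2).N) (Fin (suGroupModel 2).N) ℂ)ˣ) :
          Matrix (Fin (suGroupModel 2).N) (Fin (suGroupModel 2).N) ℂ))
      (AlphaInputsT3AC.reg68LocalSet F 𝔠 γ hγ hγ1 K k h) := by
  set S : Scales F.L := T3Scales F γ hγ (hγ1.trans (sq_min_one_le _ 𝔠.gamma0_pos)) K with hS
  obtain ⟨j, hj, p, hp, hqj, hz, hμ, hν⟩ := decode_of_mem_disc (S := S) hq
  have hq1 : q.1 = j := by rw [hqj]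
  have hL2 : 2 ≤ F.L := F.hL.2
  have hjK : j ≤ S.K := by show j ≤ K; omega
  obtain ⟨hα3, hα2, hwin⟩ := AlphaInputsT3AC.b7Window_T3 F 𝔠 γ hγ hγ1 K (show j ≤ K by omega)
  rw [hq1, hz, hμ, hν]
  refine continuousOn_of_forall_continuousAt fun U₀ hU₀ => ?_
  -- the box bound at `U₀` on the plaquette box, hence on the four bond boxes
  have hbox := hU₀ q hq
  rw [hq1, hz, hμ, hν] at hbox
  have hgj : 0 < S.gk j := gk_pos S j
  have hpos : 0 < 𝔠.C68 * (S.gk j * pFun 𝔠.lane.carrier.b₀ 𝔠.lane.carrier.p₀ (S.gk j)) * (((F.L : ℝ) ^ j)⁻¹) ^ 2 := by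
    have := 𝔠.C68_pos
    have hL : (0 : ℝ) < F.L := by exact_mod_cast (zero_lt_one.trans F.hL.2)
    have hp : 0 < pFun 𝔠.lane.carrier.b₀ 𝔠.lane.carrier.p₀ (S.gk j) := pFun_pos _ _ _ 𝔠.b₀_pos hgj (gk_le_one S S.gK_le_one j hjK)
    positivity
  have hlt : pdevOn (loK F.L j (zOf p)) (plaqHiK F.L j (zOf p) p.μ p.ν) (liftCfg (S := S) (suGroupModel 2) U₀) <
      𝔠.C68 * (S.gk j * pFun 𝔠.lane.carrier.b₀ 𝔠.lane.carrier.p₀ (S.gk j)) * (((F.L : ℝ) ^ j)⁻¹) ^ 2 := hbox.trans_lt (by linarith)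
  obtain ⟨b1, b2, b3, b4⟩ := pdevOn_bondBox_le_plaqBox (S := S) (suGroupModel 2) j (zOf p) (ne_of_lt p.hμν) U₀
  have c1 := continuousAt_val_liftAvg_of_pdevOn (S := S) (suGroupModel 2) 𝔠 hL2 hjK hα3 hα2 hwin (zOf p) p.μ (b1.trans_lt hlt)
  have c2 := continuousAt_val_liftAvg_of_pdevOn (S := S) (suGroupModel 2) 𝔠 hL2 hjK hα3 hα2 hwin (zOf p + e p.μ) p.ν (b2.trans_lt hlt)
  have c3 := continuousAt_val_liftAvg_of_pdevOn (S := S) (suGroupModel 2) 𝔠 hL2 hjK hα3 hα2 hwin (zOf p + e p.ν) p.μ (b3.trans_lt hlt)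
  have c4 := continuousAt_val_liftAvg_of_pdevOn (S := S) (suGroupModel 2) 𝔠 hL2 hjK hα3 hα2 hwin (zOf p) p.ν (b4.trans_lt hlt)
  simp only [hol_plaqWord_eq, Units.val_mul]
  have i3 : ContinuousAt (fun U : GaugeField (F.P K) 0 (Matrix.specialUnitaryGroup (Fin 2) ℂ) =>
      (((avgIter F.L (liftCfg (S := S) (suGroupModel 2) U) j (zOf p + e p.ν) p.μ)⁻¹ : (Matrix (Fin (suGroupModel 2).N) (Fin (suGroupModel 2).N) ℂ)ˣ) :
        Matrix (Fin (suGroupModel 2).N) (Fin (suGroupModel 2).N) ℂ)) U₀ := by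
    have heq : (fun U : GaugeField (F.P K) 0 (Matrix.specialUnitaryGroup (Fin 2) ℂ) =>
        (((avgIter F.L (liftCfg (S := S) (suGroupModel 2) U) j (zOf p + e p.ν) p.μ)⁻¹ : (Matrix (Fin (suGroupModel 2).N) (Fin (suGroupModel 2).N) ℂ)ˣ) :
          Matrix (Fin (suGroupModel 2).N) (Fin (suGroupModel 2).N) ℂ)) =
        Ring.inverse ∘ fun U => ((avgIter F.L (liftCfg (S := S) (suGroupModel 2) U) j (zOf p + e p.ν) p.μ :
          (Matrix (Fin (suGroupModel 2).N) (Fin (suGroupModel 2).N) ℂ)ˣ) : Matrix (Fin (suGroupModel 2).N) (Fin (suGroupModel 2).N) ℂ) :=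
      funext fun U => (Ring.inverse_unit _).symm
    rw [heq]
    exact ContinuousAt.comp (NormedRing.inverse_continuousAt _) c3
  have i4 : ContinuousAt (fun U : GaugeField (F.P K) 0 (Matrix.specialUnitaryGroup (Fin 2) ℂ) =>
      (((avgIter F.L (liftCfg (S := S) (suGroupModel 2) U) j (zOf p) p.ν)⁻¹ : (Matrix (Fin (suGroupModel 2).N) (Fin (suGroupModel 2).N) ℂ)ˣ) :
        Matrix (Fin (suGroupModel 2).N) (Fin (suGroupModel 2).N) ℂ)) U₀ := by
    have heq : (fun U : GaugeField (F.P K) 0 (Matrix.specialUnitaryGroup (Fin 2) ℂ) =>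
        (((avgIter F.L (liftCfg (S := S) (suGroupModel 2) U) j (zOf p) p.ν)⁻¹ : (Matrix (Fin (suGroupModel 2).N) (Fin (suGroupModel 2).N) ℂ)ˣ) :
          Matrix (Fin (suGroupModel 2).N) (Fin (suGroupModel 2).N) ℂ)) =
        Ring.inverse ∘ fun U => ((avgIter F.L (liftCfg (S := S) (suGroupModel 2) U) j (zOf p) p.ν :
          (Matrix (Fin (suGroupModel 2).N) (Fin (suGroupModel 2).N) ℂ)ˣ) : Matrix (Fin (suGroupModel 2).N) (Fin (suGroupModel 2).N) ℂ) :=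
      funext fun U => (Ring.inverse_unit _).symm
    rw [heq]
    exact ContinuousAt.comp (NormedRing.inverse_continuousAt _) c4
  exact ((c1.mul c2).mul i3).mul i4

/-- **AT AN ADMISSIBLE HISTORY `reg68LocalSet ∩ large67Set` IS CLOSED** (`k ≤ K`). [cite: Balaban1985UV3, (67)–(68) p.273] -/
theorem AlphaInputsT3AC.isClosed_reg68LocalSet_inter_large67Set {k : ℕ} (hk : k ≤ K) {h : Hist (F.P K) k} :
    IsClosed (AlphaInputsT3AC.reg68LocalSet F 𝔠 γ hγ hγ1 K k h ∩ AlphaInputsT3AC.large67Set F 𝔠 γ hγ hγ1 K k h) := by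
  have hC := AlphaInputsT3AC.isClosed_reg68LocalSet (𝔠 := 𝔠) (hγ := hγ) (hγ1 := hγ1) hk h
  refine AlphaInputsT3AC.isClosed_inter_setOf_forall hC (Hist.disc h) fun q hq => ?_
  have hcont := (AlphaInputsT3AC.continuousOn_hol_disc_reg68Local (𝔠 := 𝔠) (hγ := hγ) (hγ1 := hγ1) hk hq).sub
    (continuousOn_const (c := (1 : Matrix (Fin (suGroupModel 2).N) (Fin (suGroupModel 2).N) ℂ)))
  exact hcont.norm.preimage_isClosed_of_isClosed hC isClosed_Ici

/-- **THE W-INDEPENDENT CORE OF `𝒞_R` IS CLOSED** (`k ≤ K`): localised small-loop class ∩ (read-local (68) set ∩ (67)-largeness).  (No admissibility needed.)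
[cite: Balaban1985UV3, (67)–(68) p.273] -/
theorem AlphaInputsT3AC.isClosed_adaptedCoreR {k : ℕ} (hk : k ≤ K) {h : Hist (F.P K) k} :
    IsClosed (AlphaInputsT3AC.localSmallT3 F 𝔠 γ hγ hγ1 K k h ∩
      (AlphaInputsT3AC.reg68LocalSet F 𝔠 γ hγ hγ1 K k h ∩ AlphaInputsT3AC.large67Set F 𝔠 γ hγ hγ1 K k h)) :=
  (AlphaInputsT3AC.isClosed_localSmallT3 hk h).inter (AlphaInputsT3AC.isClosed_reg68LocalSet_inter_large67Set (𝔠 := 𝔠) (hγ := hγ) (hγ1 := hγ1) hk)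

end T3

end Summit.QuantumFields.YangMills.Theorems

end
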